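import Summits.NavierStokesRegularity.NavierStokesRegularity.Theses.FrozenSignCascade
import Summits.NavierStokesRegularity.NavierStokesRegularity.Theorems.FrozenSignCascadeBoundedEnvelopeContinuationOfLiouville
import Literature.Analysis.FluidPDE.SereginSverakLocalHolderBoundHolds
import Literature.Analysis.FluidPDE.AxisymmetricL3OffAxis
import Literature.Analysis.FluidPDE.SereginSverakAxisDecay
import Literature.Analysis.FluidPDE.LocalTypeI
import Literature.Analysis.FluidPDE.AxisymmetricEuler
import HarnessLib

/-!
# Route FrozenSignCascade · crux `BoundedEnvelopeContinuation` (stmt-NavierStokesRegularity-10579)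
# — AX3: assembly of (B) on the AXISYMMETRIC class from three analytic sub-goals

**Theorem (`boundedEnvelopeContinuation_axisymmetric_of`).** Assume

* (AX0) axisymmetry of a Clay datum propagates to every classical Leray–Hopf solution from it;
* (AX1) axis decay at unit scale: a classical axisymmetric solution `(w, ϖ)` (viscosity `1`) on
  `(-25, 0) × ℝ³` with finite Albritton–Barker Type I quantity on `Q((0,0),5)` satisfies
  `|x'| ‖w‖ ≤ C` on the unit Seregin–Šverák cylinder `Q(0,1)`;
* (AX2) the zoom bundle at an axis point `x₀` of a classical Leray–Hopf solution `(u, p)` on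
  `[0, T)` which is bounded on closed sub-slabs, axisymmetric, and obeys a scale-invariant Morrey
  bound on every slice: a parabolic zoom `w s y = α u (T + β s) (x₀ + R y)` which is classical with
  viscosity `1` on `(-25, 0)`, axisymmetric, locally Type I on `Q((0,0),5)`, a Seregin–Šverák local
  axisymmetric solution bounded away from the final time, and such that regularity of `w` at the
  origin gives backward boundedness of `u` at `(T, x₀)`.

Then crux (B) holds for every AXISYMMETRIC Clay datum: a bounded critical Fourier envelope at every
horizon launches a global smooth bounded-energy solution.

**Proof.** First half verbatim from `boundedEnvelopeContinuation_of_liouvilleMorrey`: reduce to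
backward boundedness of every classical Leray–Hopf solution `(u, p)` from `u₀` at every `(T, x₀)`
(`stub_clayOfBackwardBounded`); `u` is the Kato solution (`isKatoSolutionOn_of_classical`),
identified on closed sub-slabs with the Tao-class states of `stub_stateOfKato`, whence bounded on
closed sub-slabs and (envelope hypothesis + `stub_morreyOfEnvelope`) Morrey-bounded on every slice.
Second half: `u` is axisymmetric by (AX0). On the axis (`x₀ 0 = x₀ 1 = 0`), (AX2) gives the zoom
`w`; (AX1) gives its axis decay (r4), so Seregin–Šverák 2009, Thm. 3.2
(`SereginSverak2009.isRegularAtOrigin_of_axisDecay_holds`) makes the origin regular for `w`, hence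
`u` backward bounded at `(T, x₀)`. Off the axis (`cylRadius x₀ ≠ 0`),
`axisymmetricL3_boundedNearTop_offAxis` (Seregin–Šverák 2009, §3; no Type I assumption) applies to
the standing hypotheses `AxisymmetricL3Hyp ν T u p`.

Sources: G. Seregin, V. Šverák, Comm. PDE 34 (2009) = arXiv:0804.1803, Thm. 3.2 and §3;
G. Koch, N. Nadirashvili, G. Seregin, V. Šverák, Acta Math. 203 (2009), Thm. 5.3.
-/

noncomputable section

set_option linter.dupNamespace false -- nested layout Summit.<S>.<Sub>, Sub = S (D-0017)

open Set MeasureTheory Filter Topology Metric Function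
open scoped ENNReal NNReal
open Literature.Analysis Literature.Analysis.FluidPDE Literature.Analysis.FluidPDE.FourierNS

namespace Summit.NavierStokesRegularity.NavierStokesRegularity.Theorems.BoundedEnvelope

-- first half adapted from Summits/NavierStokesRegularity/NavierStokesRegularity/Theorems/
-- FrozenSignCascadeBoundedEnvelopeContinuationOfLiouville.lean
-- (boundedEnvelopeContinuation_of_liouvilleMorrey)
/-- **AX3: crux (B) on the axisymmetric class, assembled from (AX0) axisymmetry propagation,
(AX1) axis decay at unit scale and (AX2) the zoom bundle at an axis point** (statement and proof
in the module docstring). On the axis: Seregin–Šverák 2009, Thm. 3.2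
(`SereginSverak2009.isRegularAtOrigin_of_axisDecay_holds`); off the axis:
`axisymmetricL3_boundedNearTop_offAxis`; conclusion by `stub_clayOfBackwardBounded`.
[cite: SereginSverak2009, Thm. 3.2 and §3 (arXiv:0804.1803, p. 9)] -/
theorem boundedEnvelopeContinuation_axisymmetric_of :
    (∀ ν : ℝ, 0 < ν → ∀ (u₀ : EuclideanSpace ℝ (Fin 3) → EuclideanSpace ℝ (Fin 3)),
      ContDiff ℝ (⊤ : ℕ∞) u₀ → Literature.Analysis.FluidPDE.HasRapidSpatialDecay u₀ →
      Literature.Analysis.FluidPDE.NSWave0.IsDivFree u₀ →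
      Literature.Analysis.FluidPDE.IsAxisymmetric u₀ →
      ∀ T : ℝ, 0 < T → ∀ (u : ℝ → EuclideanSpace ℝ (Fin 3) → EuclideanSpace ℝ (Fin 3))
        (p : ℝ → EuclideanSpace ℝ (Fin 3) → ℝ),
        Literature.Analysis.FluidPDE.IsClassicalNSSolutionOn (Set.Ico 0 T) ν 0 u p →
        Literature.Analysis.FluidPDE.IsLerayHopfOn T ν 0 u₀ u → u 0 = u₀ →
        ∀ t ∈ Set.Ico 0 T, Literature.Analysis.FluidPDE.IsAxisymmetric (u t)) →
    (∀ (w : ℝ → EuclideanSpace ℝ (Fin 3) → EuclideanSpace ℝ (Fin 3))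
      (ϖ : ℝ → EuclideanSpace ℝ (Fin 3) → ℝ),
      Literature.Analysis.FluidPDE.IsClassicalNSSolutionOn (Set.Ioo (-25) 0) 1 0 w ϖ →
      (∀ t ∈ Set.Ioo (-25 : ℝ) 0, Literature.Analysis.FluidPDE.IsAxisymmetric (w t)) →
      Literature.Analysis.FluidPDE.typeIBound
          (Literature.Analysis.FluidPDE.parabolicCylinder 5 ((0 : ℝ), (0 : EuclideanSpace ℝ (Fin 3))))
          w ϖ (fun t x => fderiv ℝ (w t) x) < ⊤ →
      ∃ C : ℝ, ∀ z ∈ Literature.Analysis.FluidPDE.SereginSverak2009.parCyl 0 1,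
        Literature.Analysis.FluidPDE.cylRadius z.2 * ‖w z.1 z.2‖ ≤ C) →
    (∀ ν T : ℝ, 0 < ν → 0 < T →
      ∀ (u : ℝ → EuclideanSpace ℝ (Fin 3) → EuclideanSpace ℝ (Fin 3))
        (p : ℝ → EuclideanSpace ℝ (Fin 3) → ℝ),
        Literature.Analysis.FluidPDE.IsClassicalNSSolutionOn (Set.Ico 0 T) ν 0 u p →
        Literature.Analysis.FluidPDE.IsLerayHopfOn T ν 0 (u 0) u →
        (∀ t < T, ∃ B : ℝ, ∀ s ∈ Set.Icc 0 t, ∀ x, ‖u s x‖ ≤ B) →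
        (∀ t ∈ Set.Ico 0 T, Literature.Analysis.FluidPDE.IsAxisymmetric (u t)) →
        (∃ M : ℝ, ∀ t ∈ Set.Ioo 0 T, ∀ (x₁ : EuclideanSpace ℝ (Fin 3)) (r : ℝ), 0 < r →
          ∫ x in Metric.ball x₁ r, ‖u t x‖ ^ 2 ≤ M * r) →
        ∀ x₀ : EuclideanSpace ℝ (Fin 3), x₀ 0 = 0 → x₀ 1 = 0 →
        ∃ (α β R : ℝ) (w : ℝ → EuclideanSpace ℝ (Fin 3) → EuclideanSpace ℝ (Fin 3))
          (ϖ : ℝ → EuclideanSpace ℝ (Fin 3) → ℝ),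
          0 < α ∧ 0 < β ∧ 0 < R ∧
          (∀ s y, w s y = α • u (T + β * s) (x₀ + R • y)) ∧
          Literature.Analysis.FluidPDE.IsClassicalNSSolutionOn (Set.Ioo (-25) 0) 1 0 w ϖ ∧
          (∀ s ∈ Set.Ioo (-25 : ℝ) 0, Literature.Analysis.FluidPDE.IsAxisymmetric (w s)) ∧
          Literature.Analysis.FluidPDE.typeIBound
            (Literature.Analysis.FluidPDE.parabolicCylinder 5 ((0 : ℝ), (0 : EuclideanSpace ℝ (Fin 3))))
            w ϖ (fun s y => fderiv ℝ (w s) y) < ⊤ ∧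
          Literature.Analysis.FluidPDE.SereginSverak2009.IsAxisymmetricLocalSolution w ϖ ∧
          Literature.Analysis.FluidPDE.SereginSverak2009.IsBoundedAwayFromZero w ∧
          (Literature.Analysis.FluidPDE.SereginSverak2009.IsRegularAtOrigin w →
            Literature.Analysis.FluidPDE.IsBackwardBoundedAt u T x₀)) →
    ∀ ν : ℝ, 0 < ν → ∀ (u₀ : EuclideanSpace ℝ (Fin 3) → EuclideanSpace ℝ (Fin 3))
      (hu : ContDiff ℝ (⊤ : ℕ∞) u₀) (hd : Literature.Analysis.FluidPDE.HasRapidSpatialDecay u₀),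
      Literature.Analysis.FluidPDE.NSWave0.IsDivFree u₀ →
      Literature.Analysis.FluidPDE.IsAxisymmetric u₀ →
      (∀ T₀ : ℝ, 0 < T₀ → ∃ C : ℝ, ∀ T : ℝ, T ≤ T₀ →
        ∀ V : ℝ → EuclideanSpace ℝ (Fin 3) → Fin 3 → ℂ,
          Literature.Analysis.FluidPDE.FourierNS.IsFourierMild (4 * Real.pi ^ 2 * ν) 4 0 T V →
          V 0 = Literature.Analysis.FluidPDE.FourierNS.fourierData hu hd →
          ∀ t ∈ Set.Icc 0 T, ∀ ξ : EuclideanSpace ℝ (Fin 3), ‖ξ‖ ^ 2 * ‖V t ξ‖ ≤ C) →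
      ∃ (u : ℝ → EuclideanSpace ℝ (Fin 3) → EuclideanSpace ℝ (Fin 3))
        (p : ℝ → EuclideanSpace ℝ (Fin 3) → ℝ),
        Literature.Analysis.FluidPDE.IsSmoothOnHalfSpace u ∧
        Literature.Analysis.FluidPDE.IsSmoothOnHalfSpace p ∧
        Literature.Analysis.FluidPDE.IsNavierStokesSolution ν 0 u₀ u p ∧
        Literature.Analysis.FluidPDE.HasBoundedEnergy u := by
  intro h0 h1 h2 ν hν u₀ hu hd hdiv hax hbdd
  refine stub_clayOfBackwardBounded ν hν u₀ hu hd hdiv ?_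
  intro T hT u p hsol hLH hu0 x₀
  -- the classical Leray–Hopf solution is a Kato solution on `[0, T)`
  have hLH' : IsLerayHopfOn T ν 0 (u 0) u := by rw [hu0]; exact hLH
  have hd0 : HasRapidSpatialDecay (u 0) := by rw [hu0]; exact hd
  have hK : IsKatoSolutionOn T ν u₀ u := by
    have h := isKatoSolutionOn_of_classical hν hT hsol hLH' hd0
    rwa [hu0] at h
  -- the envelope constant at horizon `T` and the Morrey constant
  obtain ⟨C, hC⟩ := hbdd T hT
  obtain ⟨κ, _, hMor⟩ := stub_morreyOfEnvelope
  -- Tao-class states with Fourier side on `[0, Tt]`, `Tt < T`, identified with `u`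
  have hstate : ∀ Tt : ℝ, 0 < Tt → Tt < T →
      ∃ (u' : ℝ → EuclideanSpace ℝ (Fin 3) → EuclideanSpace ℝ (Fin 3))
        (p' : ℝ → EuclideanSpace ℝ (Fin 3) → ℝ) (V : ℝ → EuclideanSpace ℝ (Fin 3) → Fin 3 → ℂ),
        IsTaoSolutionOn Tt ν u₀ u' p' ∧ IsFourierMild (4 * Real.pi ^ 2 * ν) 4 0 Tt V ∧
        (∀ t ∈ Icc 0 Tt, u' t = synthVel (V t)) ∧ V 0 = fourierData hu hd ∧
        ∀ t ∈ Icc 0 Tt, u' t = u t := by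
    intro Tt hTt0 hTtT
    obtain ⟨u', p', V, hTao, hV, hsyn, hV0⟩ :=
      stub_stateOfKato ν hν u₀ hu hd hdiv T u hK Tt hTt0 hTtT
    refine ⟨u', p', V, hTao, hV, hsyn, hV0, fun t htI => ?_⟩
    have hae : u' t =ᵐ[volume] u t :=
      hTao.ae_eq_of_kato_Icc hν hTt0 (hK.mild.mono (Ico_subset_Ico_right hTtT.le))
        (hK.continuousInLpOn.mono fun s hs => ⟨hs.1, lt_of_le_of_lt hs.2 hTtT⟩)
        (hK.aestronglyMeasurable.mono_measure (Measure.restrict_mono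
          (Set.prod_mono (Ioo_subset_Ioo_right hTtT.le) Subset.rfl) le_rfl)) t htI
    exact (Continuous.ae_eq_iff_eq volume (hTao.classical.contDiff_velocity htI).continuous
      (hsol.contDiff_velocity ⟨htI.1, lt_of_le_of_lt htI.2 hTtT⟩).continuous).1 hae
  -- boundedness of `u` on closed sub-slabs
  have hbd : ∀ t < T, ∃ B : ℝ, ∀ s ∈ Icc 0 t, ∀ x, ‖u s x‖ ≤ B := by
    intro t htT
    set Tt : ℝ := (max t 0 + T) / 2 with hTt
    have hTt0 : 0 < Tt := by
      rw [hTt]; linarith [le_max_right t 0]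
    have hTtT : Tt < T := by
      rw [hTt]
      have : max t 0 < T := max_lt htT hT
      linarith
    have htTt : t ≤ Tt := by
      rw [hTt]
      have : max t 0 < T := max_lt htT hT
      linarith [le_max_left t 0]
    obtain ⟨u', p', V, hTao, -, -, -, heq⟩ := hstate Tt hTt0 hTtT
    obtain ⟨B, -, hB⟩ := hTao.exists_bound_velocity
    refine ⟨B, fun s hs x => ?_⟩
    rw [← heq s ⟨hs.1, hs.2.trans htTt⟩]
    exact hB s ⟨hs.1, hs.2.trans htTt⟩ x
  -- the Morrey bound on every slice `0 < t < T`, at every radius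
  have hMorrey : ∀ t ∈ Ioo 0 T, ∀ (x₁ : EuclideanSpace ℝ (Fin 3)) (r : ℝ), 0 < r →
      ∫ x in ball x₁ r, ‖u t x‖ ^ 2 ≤ κ * C ^ 2 * r := by
    intro t ht x₁ r hr
    set Tt : ℝ := (t + T) / 2 with hTt
    have hTt0 : 0 < Tt := by rw [hTt]; linarith [ht.1, ht.2]
    have htTt : t < Tt := by rw [hTt]; linarith [ht.2]
    have hTtT : Tt < T := by rw [hTt]; linarith [ht.2]
    obtain ⟨u', p', V, hTao, hV, hsyn, hV0, heq⟩ := hstate Tt hTt0 hTtT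
    have htI : t ∈ Icc 0 Tt := ⟨ht.1.le, htTt.le⟩
    have henv : ∀ ξ : EuclideanSpace ℝ (Fin 3), ‖ξ‖ ^ 2 * ‖V t ξ‖ ≤ C :=
      fun ξ => hC Tt hTtT.le V hV hV0 t htI ξ
    have hC0 : 0 ≤ C := le_trans (by positivity) (henv 0)
    have hdecV : ∀ K : ℕ, ∃ B, HasDecay K B (V t) := fun K => by
      obtain ⟨B, hB⟩ := hV.decay K
      exact ⟨B, hB t⟩
    have hm := hMor C (V t) hC0 (hV.continuous_slice t) hdecV (fun ξ l => hV.conjSymm t ξ l) henv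
      x₁ r hr
    rw [← heq t htI, hsyn t htI]
    exact hm
  -- every slice of `u` is axisymmetric (AX0)
  have haxi : ∀ t ∈ Ico 0 T, IsAxisymmetric (u t) :=
    h0 ν hν u₀ hu hd hdiv hax T hT u p hsol hLH hu0
  by_cases hx : x₀ 0 = 0 ∧ x₀ 1 = 0
  · -- ### axis point: zoom bundle (AX2), axis decay (AX1), Seregin–Šverák 2009, Thm. 3.2
    obtain ⟨α, β, R, w, ϖ, hα, hβ, hR, hw, hcl, hwax, hI, hals, hr2, hreg⟩ :=
      h2 ν T hν hT u p hsol hLH' hbd haxi ⟨κ * C ^ 2, hMorrey⟩ x₀ hx.1 hx.2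
    obtain ⟨Cd, hCd⟩ := h1 w ϖ hcl hwax hI
    have hr4 : SereginSverak2009.IsAxisDecayOnCyl w :=
      ⟨Cd, (ae_restrict_iff' (SereginSverak2009.isOpen_parCyl _ _).measurableSet).2
        (ae_of_all _ hCd)⟩
    exact hreg (SereginSverak2009.isRegularAtOrigin_of_axisDecay_holds hals hr2 hr4)
  · -- ### off-axis point: Seregin–Šverák 2009, §3 (no Type I assumption needed)
    have hx₀ : cylRadius x₀ ≠ 0 := fun h => hx ((cylRadius_eq_zero_iff x₀).1 h)
    have H : AxisymmetricL3Hyp ν T u p := ⟨hν, hT, hsol, hLH', hbd, haxi⟩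
    obtain ⟨r, hr, K, hK⟩ := axisymmetricL3_boundedNearTop_offAxis H x₀ hx₀
    exact ⟨r, hr, K, hK⟩

end Summit.NavierStokesRegularity.NavierStokesRegularity.Theorems.BoundedEnvelope

end
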